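import Summits.Ventures.PercRepro.RankLevelSetTightArith

/-!
# PercRepro — [WORKAROUND COPY, (um)(35)(2)–(4): the primed (`_S`) re-statement of RankLevelSetTightArithB, whose landed copy (the citation of record) has no olean; every declaration carries the `_S` suffix]
# THE BINOMIAL INEQUALITY J(p,q) OF THE TIGHT LAYER (night-1, gen 9; dossier §19.7, part 2 of 2)

With `Φ = phiK`, `n = p + q`, `d = p − q ≥ 2`, `1 ≤ q`:

* `prod_one_add_le_inv_one_sub_S` — `Π_{i<k} (1 + a_i) ≤ 1/(1 − Σ_{i<k} a_i)` for nonnegative `a` with partial sum `< 1`;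
* `choose_add_div_choose_eq_prod_S` — `C(m,q+k)/C(m,q) = Π_{i<k} (m−q−i)/(q+i+1)`;
* `sum_ratio_le_S`, `self_le_choose_S` — the two elementary estimates;
* `phiK_pred_le_of_case_B_S` — for `(d−1)² < 4q`: `Φ(p−1,q) ≤ (d−2)/(1 − (d−1)²/(4q))`, from
  `C(n−1,q+k)/C(n−1,q) = Π_{i≤k} (p−i)/(q+i) ≤ 1/(1 − Σ_{i≤k} (d−2i)/(q+i))` for `2k ≤ d − 1` and the symmetry
  `C(n−1,q+k) = C(n−1,q+d−1−k)`;
* **`phiK_pred_le_mul_weight_S`** (J(p,q)) — `Φ(p−1,q) ≤ (p−q)·(Σ_{q<u<p} C(p−1,u)/C(n−u,p−u) + (C(p−1,q)−1)/C(p−1,q))`: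
  case `(p−q)² ≥ p+q` directly from `phiK_mul_eq`, else the case-B bound and the polynomial identity
  `2d(p−1)(4q−(d−1)²) − 4q(d−2)(n−d²) = 8q(2q − d(d−1)) + 2d(d−1)(q(d+5) − (d−1)²)`.

Axioms: standard.
-/

namespace PercRepro

open Finset

/-- `Π_{i<k} (1 + a i) ≤ 1 / (1 − Σ_{i<k} a i)` for `a` nonnegative below `k` with partial sum `< 1`. -/
lemma prod_one_add_le_inv_one_sub_S (a : ℕ → ℚ) :
    ∀ k : ℕ, (∀ i ∈ Finset.range k, 0 ≤ a i) → ∑ i ∈ Finset.range k, a i < 1 →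
      ∏ i ∈ Finset.range k, (1 + a i) ≤ 1 / (1 - ∑ i ∈ Finset.range k, a i) := by
  intro k
  induction k with
  | zero => intro _ _; simp
  | succ k ih =>
    intro ha hS
    have ha' : ∀ i ∈ Finset.range k, 0 ≤ a i := fun i hi => ha i (Finset.mem_range.2 (by
      rw [Finset.mem_range] at hi; omega))
    have hak : 0 ≤ a k := ha k (Finset.mem_range.2 (by omega))
    rw [Finset.prod_range_succ, Finset.sum_range_succ] at *
    have hSk : ∑ i ∈ Finset.range k, a i < 1 := by linarith
    have h1 := ih ha' hSk
    set S := ∑ i ∈ Finset.range k, a i with hSdef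
    have hpos1 : 0 < 1 - S := by linarith
    have hpos2 : 0 < 1 - (S + a k) := by linarith
    have hS0 : 0 ≤ S := Finset.sum_nonneg ha'
    calc (∏ i ∈ Finset.range k, (1 + a i)) * (1 + a k)
        ≤ 1 / (1 - S) * (1 + a k) := mul_le_mul_of_nonneg_right h1 (by linarith)
      _ ≤ 1 / (1 - (S + a k)) := by
          rw [div_mul_eq_mul_div, div_le_div_iff₀ hpos1 hpos2]
          nlinarith [mul_nonneg hak hS0, mul_nonneg hak hak]

/-- `C(m, q+k) / C(m, q) = Π_{i<k} (m − q − i) / (q + i + 1)` for `q + k ≤ m`. -/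
lemma choose_add_div_choose_eq_prod_S (m q : ℕ) :
    ∀ k : ℕ, q + k ≤ m →
      ((m.choose (q + k) : ℕ) : ℚ) / ((m.choose q : ℕ) : ℚ) =
        ∏ i ∈ Finset.range k, (((m - q - i : ℕ) : ℚ) / ((q + i + 1 : ℕ) : ℚ)) := by
  intro k
  induction k with
  | zero =>
    intro _
    have hpos : (0 : ℚ) < ((m.choose q : ℕ) : ℚ) := by exact_mod_cast Nat.choose_pos (by omega)
    simp [div_self hpos.ne']
  | succ k ih =>
    intro hk
    rw [Finset.prod_range_succ, ← ih (by omega)]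
    have h := Nat.choose_succ_right_eq m (q + k)
    have hpos : (0 : ℚ) < ((q + k + 1 : ℕ) : ℚ) := by positivity
    have hq : (0 : ℚ) < ((m.choose q : ℕ) : ℚ) := by exact_mod_cast Nat.choose_pos (by omega)
    have h' : ((m.choose (q + k + 1) : ℕ) : ℚ) * ((q + k + 1 : ℕ) : ℚ) =
        ((m.choose (q + k) : ℕ) : ℚ) * ((m - (q + k) : ℕ) : ℚ) := by exact_mod_cast h
    rw [show q + (k + 1) = q + k + 1 by ring, show m - q - k = m - (q + k) by omega]
    rw [div_mul_div_comm, div_eq_div_iff hq.ne' (by positivity)]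
    linear_combination ((m.choose q : ℕ) : ℚ) * h'

/-- The partial sums `Σ_{i<k} (d − 2(i+1))/(q + i + 1) ≤ (d − 1)² / (4q)` for `2k ≤ d − 1`. -/
lemma sum_ratio_le_S {d q : ℕ} (hq : 1 ≤ q) (hd : 2 ≤ d) (k : ℕ) (hk : 2 * k ≤ d - 1) :
    ∑ i ∈ Finset.range k, (((d : ℚ) - 2 * ((i + 1 : ℕ) : ℚ)) / ((q + i + 1 : ℕ) : ℚ)) ≤
      ((d : ℚ) - 1) ^ 2 / (4 * (q : ℚ)) := by
  have hq' : (0 : ℚ) < (q : ℚ) := by exact_mod_cast hq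
  -- termwise: (d − 2(i+1))/(q+i+1) ≤ (d − 2(i+1))/q since the numerator is ≥ 0
  have hterm : ∀ i ∈ Finset.range k, ((d : ℚ) - 2 * ((i + 1 : ℕ) : ℚ)) / ((q + i + 1 : ℕ) : ℚ) ≤
      ((d : ℚ) - 2 * ((i + 1 : ℕ) : ℚ)) / (q : ℚ) := by
    intro i hi
    rw [Finset.mem_range] at hi
    have hnum : (0 : ℚ) ≤ (d : ℚ) - 2 * ((i + 1 : ℕ) : ℚ) := by
      have : 2 * (i + 1) ≤ d := by omega
      have h2 : ((2 * (i + 1) : ℕ) : ℚ) ≤ (d : ℚ) := by exact_mod_cast this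
      push_cast at h2 ⊢
      linarith
    apply div_le_div_of_nonneg_left hnum hq'
    have : (q : ℚ) ≤ ((q + i + 1 : ℕ) : ℚ) := by exact_mod_cast (by omega : q ≤ q + i + 1)
    exact this
  refine le_trans (Finset.sum_le_sum hterm) ?_
  rw [← Finset.sum_div]
  -- Σ_{i<k} (d − 2(i+1)) = k·d − k(k+1) = k(d − 1 − k) ≤ (d−1)²/4
  have hsum : ∑ i ∈ Finset.range k, ((d : ℚ) - 2 * ((i + 1 : ℕ) : ℚ)) =
      (k : ℚ) * (d : ℚ) - (k : ℚ) * ((k : ℚ) + 1) := by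
    rw [Finset.sum_sub_distrib, Finset.sum_const, Finset.card_range, nsmul_eq_mul]
    rw [← Finset.mul_sum]
    have hg : ∑ i ∈ Finset.range k, ((i + 1 : ℕ) : ℚ) = (k : ℚ) * ((k : ℚ) + 1) / 2 := by
      have h := Finset.sum_range_id_mul_two (k + 1)
      rw [Finset.sum_range_succ'] at h
      simp only [Nat.add_sub_cancel, add_zero] at h
      have h' : ((∑ i ∈ Finset.range k, (i + 1 : ℕ) : ℕ) : ℚ) * 2 = ((k + 1 : ℕ) : ℚ) * (k : ℚ) := by
        exact_mod_cast h
      push_cast at h' ⊢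
      linarith
    rw [hg]
    ring
  rw [hsum]
  rw [div_le_div_iff₀ hq' (by positivity)]
  have hk' : (2 * (k : ℚ)) ≤ (d : ℚ) - 1 := by
    have : ((2 * k : ℕ) : ℚ) ≤ ((d - 1 : ℕ) : ℚ) := by exact_mod_cast hk
    push_cast [Nat.cast_sub (by omega : 1 ≤ d)] at this
    linarith
  nlinarith [sq_nonneg ((d : ℚ) - 1 - 2 * (k : ℚ)), hq']

/-- `m ≤ C(m, j)` for `1 ≤ j ≤ m − 1`. -/
lemma self_le_choose_S {m j : ℕ} (hj1 : 1 ≤ j) (hjm : j + 1 ≤ m) : m ≤ m.choose j := by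
  -- first for `j ≤ m / 2`, by the unimodality step
  have hA : ∀ i, 1 ≤ i → i ≤ m / 2 → m ≤ m.choose i := by
    intro i
    induction i with
    | zero => intro h; omega
    | succ i ih =>
      intro _ hi
      rcases Nat.eq_zero_or_pos i with hi0 | hi0
      · subst hi0
        simp
      · have h1 := ih hi0 (by omega)
        have h2 := Nat.choose_le_succ_of_lt_half_left (r := i) (n := m) (by omega)
        exact le_trans h1 h2
  by_cases hhalf : j ≤ m / 2
  · exact hA j hj1 hhalf
  · have h1 : m ≤ m.choose (m - j) := hA (m - j) (by omega) (by omega)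
    rwa [Nat.choose_symm (by omega)] at h1

/-- **The case-B bound**: for `1 ≤ q`, `3 ≤ d`, `(d − 1)² < 4q` and `1 ≤ k ≤ d − 2`,
`C(2q+d−1, q+k) / C(2q+d−1, q) ≤ 1 / (1 − (d−1)²/(4q))`. -/
lemma choose_ratio_le_of_case_B_S {d q : ℕ} (hq : 1 ≤ q) (hd : 3 ≤ d)
    (hB : ((d : ℚ) - 1) ^ 2 < 4 * (q : ℚ)) (k : ℕ) (hk1 : 1 ≤ k) (hk2 : k ≤ d - 2) :
    (((2 * q + d - 1).choose (q + k) : ℕ) : ℚ) / (((2 * q + d - 1).choose q : ℕ) : ℚ) ≤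
      1 / (1 - ((d : ℚ) - 1) ^ 2 / (4 * (q : ℚ))) := by
  set m := 2 * q + d - 1 with hm
  have hq' : (0 : ℚ) < (q : ℚ) := by exact_mod_cast hq
  have hx1 : ((d : ℚ) - 1) ^ 2 / (4 * (q : ℚ)) < 1 := by
    rw [div_lt_one (by positivity)]
    exact hB
  have hm' : (m : ℚ) = 2 * (q : ℚ) + (d : ℚ) - 1 := by
    rw [hm, Nat.cast_sub (by omega)]
    push_cast
    ring
  -- the bound for `2 k' ≤ d − 1`, as a product
  have key : ∀ k', 2 * k' ≤ d - 1 →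
      (((m.choose (q + k') : ℕ) : ℚ) / ((m.choose q : ℕ) : ℚ)) ≤
        1 / (1 - ((d : ℚ) - 1) ^ 2 / (4 * (q : ℚ))) := by
    intro k' hk'
    rw [choose_add_div_choose_eq_prod_S m q k' (by omega)]
    set a : ℕ → ℚ := fun i => ((d : ℚ) - 2 * ((i + 1 : ℕ) : ℚ)) / ((q + i + 1 : ℕ) : ℚ) with ha
    have hfac : ∀ i ∈ Finset.range k', (((m - q - i : ℕ) : ℚ) / ((q + i + 1 : ℕ) : ℚ)) = 1 + a i := by
      intro i hi
      rw [Finset.mem_range] at hi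
      have hpos : (0 : ℚ) < ((q + i + 1 : ℕ) : ℚ) := by positivity
      have hsub : ((m - q - i : ℕ) : ℚ) = ((q + i + 1 : ℕ) : ℚ) + ((d : ℚ) - 2 * ((i + 1 : ℕ) : ℚ)) := by
        rw [Nat.cast_sub (by omega), Nat.cast_sub (by omega), hm']
        push_cast
        ring
      rw [hsub, add_div, div_self hpos.ne']
    rw [Finset.prod_congr rfl hfac]
    have ha0 : ∀ i ∈ Finset.range k', 0 ≤ a i := by
      intro i hi
      rw [Finset.mem_range] at hi
      simp only [ha]
      apply div_nonneg _ (by positivity)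
      have h2 : ((2 * (i + 1) : ℕ) : ℚ) ≤ (d : ℚ) := by exact_mod_cast (by omega : 2 * (i + 1) ≤ d)
      push_cast at h2 ⊢
      linarith
    have hsum : ∑ i ∈ Finset.range k', a i ≤ ((d : ℚ) - 1) ^ 2 / (4 * (q : ℚ)) :=
      sum_ratio_le_S hq (by omega) k' hk'
    have hS1 : ∑ i ∈ Finset.range k', a i < 1 := lt_of_le_of_lt hsum hx1
    refine le_trans (prod_one_add_le_inv_one_sub_S a k' ha0 hS1) ?_
    apply one_div_le_one_div_of_le (by linarith)
    linarith
  by_cases hhalf : 2 * k ≤ d - 1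
  · exact key k hhalf
  · -- symmetry `C(m, q+k) = C(m, q + (d − 1 − k))`
    have hsym : m.choose (q + k) = m.choose (q + (d - 1 - k)) := by
      have h := (Nat.choose_symm (show q + k ≤ m by omega)).symm
      rwa [show m - (q + k) = q + (d - 1 - k) by omega] at h
    rw [hsym]
    exact key (d - 1 - k) (by omega)

/-- `Φ(p−1,q) ≤ (d − 2) / (1 − (d−1)²/(4q))` in case B (`d = p − q ≥ 3`, `(d−1)² < 4q`). -/
lemma phiK_pred_le_of_case_B_S {p q : ℕ} (hq : 1 ≤ q) (hd : 3 ≤ p - q) (hpq : q + 2 ≤ p)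
    (hB : (((p - q : ℕ) : ℚ) - 1) ^ 2 < 4 * (q : ℚ)) :
    phiK (p - 1) q ≤ (((p - q : ℕ) : ℚ) - 2) / (1 - (((p - q : ℕ) : ℚ) - 1) ^ 2 / (4 * (q : ℚ))) := by
  set d := p - q with hd'
  have hm : p - 1 + q = 2 * q + d - 1 := by omega
  unfold phiK
  rw [hm, Finset.sum_div]
  have hsymC : (2 * q + d - 1).choose (p - 1) = (2 * q + d - 1).choose q := by
    have h := (Nat.choose_symm (show p - 1 ≤ 2 * q + d - 1 by omega)).symm
    rwa [show 2 * q + d - 1 - (p - 1) = q by omega] at h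
  rw [hsymC]
  have hcard : (Finset.Ioo q (p - 1)).card = d - 2 := by
    rw [Nat.card_Ioo]
    omega
  calc ∑ v ∈ Finset.Ioo q (p - 1), (((2 * q + d - 1).choose v : ℕ) : ℚ) / (((2 * q + d - 1).choose q : ℕ) : ℚ)
      ≤ ∑ v ∈ Finset.Ioo q (p - 1), 1 / (1 - ((d : ℚ) - 1) ^ 2 / (4 * (q : ℚ))) := by
        refine Finset.sum_le_sum (fun v hv => ?_)
        rw [Finset.mem_Ioo] at hv
        have h := choose_ratio_le_of_case_B_S hq hd hB (v - q) (by omega) (by omega)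
        rwa [show q + (v - q) = v by omega] at h
    _ = ((d : ℚ) - 2) / (1 - ((d : ℚ) - 1) ^ 2 / (4 * (q : ℚ))) := by
        rw [Finset.sum_const, hcard, nsmul_eq_mul]
        rw [Nat.cast_sub (by omega)]
        push_cast
        ring

/-- **J(p,q)**: for `1 ≤ q`, `q + 2 ≤ p`,
`Φ(p−1,q) ≤ (p − q)·(Σ_{q<u<p} C(p−1,u)/C(p+q−u,p−u) + (C(p−1,q) − 1)/C(p−1,q))`. -/
theorem phiK_pred_le_mul_weight_S {p q : ℕ} (hq : 1 ≤ q) (hpq : q + 2 ≤ p) :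
    phiK (p - 1) q ≤ ((p - q : ℕ) : ℚ) *
      (∑ u ∈ Finset.Ioo q p, (((p - 1).choose u : ℕ) : ℚ) / (((p + q - u).choose (p - u) : ℕ) : ℚ) +
        ((((p - 1).choose q : ℕ) : ℚ) - 1) / (((p - 1).choose q : ℕ) : ℚ)) := by
  rw [weight_eq hq hpq]
  have hR := phiK_mul_eq hq hpq
  have hphi0 : 0 ≤ phiK (p - 1) q := by unfold phiK; positivity
  -- the `d = 2` case: `Φ(p−1,q) = 0`
  have hd2 : p - q = 2 → phiK (p - 1) q = 0 := by
    intro h2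
    unfold phiK
    have : Finset.Ioo q (p - 1) = ∅ := by
      ext u; simp only [Finset.mem_Ioo, Finset.notMem_empty, iff_false]; omega
    rw [this, Finset.sum_empty, zero_div]
  -- the case-B bound, stated before the variables are frozen
  have hcaseB : 3 ≤ p - q → (((p - q : ℕ) : ℚ) - 1) ^ 2 < 4 * (q : ℚ) →
      phiK (p - 1) q ≤ (((p - q : ℕ) : ℚ) - 2) / (1 - (((p - q : ℕ) : ℚ) - 1) ^ 2 / (4 * (q : ℚ))) :=
    fun hd3 hB => phiK_pred_le_of_case_B_S hq hd3 hpq hB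
  have hCp : (p : ℚ) - 1 ≤ (((p - 1).choose q : ℕ) : ℚ) := by
    have := self_le_choose_S (m := p - 1) (j := q) hq (by omega)
    have h' : ((p - 1 : ℕ) : ℚ) ≤ (((p - 1).choose q : ℕ) : ℚ) := by exact_mod_cast this
    rw [Nat.cast_sub (by omega)] at h'
    push_cast at h'
    linarith
  have hC1 : (1 : ℚ) ≤ (((p - 1).choose q : ℕ) : ℚ) := by exact_mod_cast Nat.choose_pos (by omega)
  have hD : ((p - q : ℕ) : ℚ) = (p : ℚ) - (q : ℚ) := by rw [Nat.cast_sub (by omega)]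
  have hN : ((p + q : ℕ) : ℚ) = (p : ℚ) + (q : ℚ) := by push_cast; ring
  have hq' : (1 : ℚ) ≤ (q : ℚ) := by exact_mod_cast hq
  have hpq' : (q : ℚ) + 2 ≤ (p : ℚ) := by exact_mod_cast hpq
  have hd3' : 3 ≤ p - q → (3 : ℚ) ≤ (p : ℚ) - (q : ℚ) := by
    intro h
    have : ((3 : ℕ) : ℚ) ≤ ((p - q : ℕ) : ℚ) := by exact_mod_cast h
    rw [hD] at this
    exact_mod_cast this
  have hd2' : ¬ 3 ≤ p - q → p - q = 2 := by omega
  rw [hD] at hcaseB ⊢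
  rw [hN] at hR
  -- freeze
  generalize hΦ' : phiK (p - 1) q = Φ' at *
  generalize hΦ : phiK p q = Φ at *
  generalize hC : (((p - 1).choose q : ℕ) : ℚ) = C at *
  generalize hP : (p : ℚ) = P at *
  generalize hQ : (q : ℚ) = Q at *
  have hCpos : (0 : ℚ) < C := by linarith
  have hNpos : 0 < P + Q := by linarith
  have hD0 : 0 ≤ P - Q := by linarith
  -- `Φ = (2Φ' + 2) P / (P + Q)`
  have hΦeq : Φ = (2 * Φ' + 2) * P / (P + Q) := by
    rw [eq_div_iff hNpos.ne']
    exact hR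
  rw [hΦeq]
  rw [show (P - Q) * ((2 * Φ' + 2) * P / (P + Q) - Φ' - 1 / C) =
      ((P - Q) * ((2 * Φ' + 2) * P * C - Φ' * (P + Q) * C - (P + Q))) / ((P + Q) * C) by
        field_simp]
  rw [le_div_iff₀ (by positivity)]
  -- the reduced goal: `Φ' ((P+Q) − (P−Q)²) C + (P−Q)(P+Q) ≤ 2 P (P−Q) C`
  suffices hgoal : Φ' * ((P + Q) - (P - Q) ^ 2) * C + (P - Q) * (P + Q) ≤ 2 * P * (P - Q) * C by
    have hid : (P - Q) * ((2 * Φ' + 2) * P * C - Φ' * (P + Q) * C - (P + Q)) -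
        Φ' * ((P + Q) * C) =
        2 * P * (P - Q) * C - (Φ' * ((P + Q) - (P - Q) ^ 2) * C + (P - Q) * (P + Q)) := by ring
    linarith [hgoal, hid]
  have hDN : (P - Q) * (P + Q) ≤ 2 * (P - Q) * C := by
    have : P + Q ≤ 2 * C := by linarith
    nlinarith [hD0]
  by_cases hd : 3 ≤ p - q
  · have hd3 := hd3' hd
    by_cases hA : P + Q ≤ (P - Q) ^ 2
    · -- case A
      have h1 : Φ' * ((P + Q) - (P - Q) ^ 2) * C ≤ 0 := by
        have hX : 0 ≤ (P - Q) ^ 2 - (P + Q) := by linarith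
        have h0 := mul_nonneg (mul_nonneg hphi0 hCpos.le) hX
        have hid : Φ' * ((P + Q) - (P - Q) ^ 2) * C = -(Φ' * C * ((P - Q) ^ 2 - (P + Q))) := by ring
        rw [hid]
        linarith
      have h3 : 2 * (P - Q) * C ≤ 2 * P * (P - Q) * C := by
        have h0 := mul_nonneg (mul_nonneg hD0 hCpos.le) (show (0 : ℚ) ≤ P - 1 by linarith)
        have hid : 2 * P * (P - Q) * C - 2 * (P - Q) * C = 2 * ((P - Q) * C * (P - 1)) := by ring
        linarith
      linarith [hDN, h1, h3]
    · -- case B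
      rw [not_le] at hA
      have hB : (P - Q - 1) ^ 2 < 4 * Q := by nlinarith [hA, hpq', hd3]
      have hbound := hcaseB hd hB
      have hden : 0 < 4 * Q - (P - Q - 1) ^ 2 := by linarith
      have hx : (P - Q - 2) / (1 - (P - Q - 1) ^ 2 / (4 * Q)) = 4 * Q * (P - Q - 2) / (4 * Q - (P - Q - 1) ^ 2) := by
        have hQpos : (0 : ℚ) < Q := by linarith
        rw [div_eq_div_iff (by
          rw [sub_ne_zero]
          intro h
          have : (P - Q - 1) ^ 2 = 4 * Q := by
            field_simp at h
            linarith
          linarith) hden.ne']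
        field_simp
      rw [hx, le_div_iff₀ hden] at hbound
      have hNd : 0 < (P + Q) - (P - Q) ^ 2 := by linarith
      -- the polynomial inequality
      have hpoly : 4 * Q * (P - Q - 2) * ((P + Q) - (P - Q) ^ 2) ≤
          2 * (P - Q) * (P - 1) * (4 * Q - (P - Q - 1) ^ 2) := by
        have e1 : 0 ≤ 2 * Q - (P - Q) * (P - Q - 1) := by nlinarith [hA]
        have e2 : 0 ≤ Q * (P - Q + 5) - (P - Q - 1) ^ 2 := by nlinarith [e1, hd3, hq']
        have hid : 2 * (P - Q) * (P - 1) * (4 * Q - (P - Q - 1) ^ 2) -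
            4 * Q * (P - Q - 2) * ((P + Q) - (P - Q) ^ 2) =
            8 * Q * (2 * Q - (P - Q) * (P - Q - 1)) +
              2 * (P - Q) * (P - Q - 1) * (Q * (P - Q + 5) - (P - Q - 1) ^ 2) := by ring
        have hnn : 0 ≤ 8 * Q * (2 * Q - (P - Q) * (P - Q - 1)) +
            2 * (P - Q) * (P - Q - 1) * (Q * (P - Q + 5) - (P - Q - 1) ^ 2) := by
          have hQ0 : (0 : ℚ) ≤ Q := by linarith
          have hD1 : (0 : ℚ) ≤ P - Q - 1 := by linarith
          positivity
        linarith [hid, hnn]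
      have hstep : Φ' * ((P + Q) - (P - Q) ^ 2) * C * (4 * Q - (P - Q - 1) ^ 2) ≤
          2 * (P - Q) * (P - 1) * C * (4 * Q - (P - Q - 1) ^ 2) := by
        calc Φ' * ((P + Q) - (P - Q) ^ 2) * C * (4 * Q - (P - Q - 1) ^ 2)
            = (Φ' * (4 * Q - (P - Q - 1) ^ 2)) * (((P + Q) - (P - Q) ^ 2) * C) := by ring
          _ ≤ (4 * Q * (P - Q - 2)) * (((P + Q) - (P - Q) ^ 2) * C) :=
              mul_le_mul_of_nonneg_right hbound (by positivity)
          _ = (4 * Q * (P - Q - 2) * ((P + Q) - (P - Q) ^ 2)) * C := by ring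
          _ ≤ (2 * (P - Q) * (P - 1) * (4 * Q - (P - Q - 1) ^ 2)) * C :=
              mul_le_mul_of_nonneg_right hpoly hCpos.le
          _ = 2 * (P - Q) * (P - 1) * C * (4 * Q - (P - Q - 1) ^ 2) := by ring
      have hstep' : Φ' * ((P + Q) - (P - Q) ^ 2) * C ≤ 2 * (P - Q) * (P - 1) * C :=
        le_of_mul_le_mul_right hstep hden
      calc Φ' * ((P + Q) - (P - Q) ^ 2) * C + (P - Q) * (P + Q)
          ≤ 2 * (P - Q) * (P - 1) * C + 2 * (P - Q) * C := add_le_add hstep' hDN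
        _ = 2 * P * (P - Q) * C := by ring
  · -- `d = 2`: `Φ' = 0`
    have h2 := hd2 (hd2' hd)
    rw [h2]
    have h3 : 2 * (P - Q) * C ≤ 2 * P * (P - Q) * C := by
      have h0 := mul_nonneg (mul_nonneg hD0 hCpos.le) (show (0 : ℚ) ≤ P - 1 by linarith)
      have hid : 2 * P * (P - Q) * C - 2 * (P - Q) * C = 2 * ((P - Q) * C * (P - 1)) := by ring
      linarith
    have h4 : (0 : ℚ) * ((P + Q) - (P - Q) ^ 2) * C = 0 := by ring
    linarith [hDN, h3, h4]

end PercRepro
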